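import Summits.ABC.IUTFork.Conditional.AbcOfSGenuineKTameRobustThirty
import Literature.IUT.LogVolume.GenuineTowerLocalTypeTate
import HarnessLib

/-!
# Branch C / R-W lane W: the ROBUST tame-exact refutation with the TATE-EXACT local type — UNCONDITIONAL per-datum refutations
# of the hull-level clause S_H at abc-triple data over pole primes `p ≥ 10·l + 2` (`3 ∣ v_p(abc)`) and `p ≥ 6·l + 2` (`5 ∣ v_p(abc)`)

PROOF-ONLY file (no `def`, no new `Prop`, no instance) of the abc-iut cell (seat abc-iut-W-ref-2, gen 0; director-abc g3 MINT-LIST BATCH 1,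
ROW «TARGETS.tsv kind TE rows 26–51»; sequel of abc-iut-w5-d107's `AbcOfSGenuineKTameRobustThirty` p462147, prime floor `30·l + 2`).
TAKES NO SIDE on [IUTchIII] Cor. 3.12 or on any author. The remaining «TE, ALL e» rows of HOME/plan/rescue/R-W/TARGETS.tsv have pole prime
`p < 30·l + 2`; for them lattice-tameness `e(K_{x₀}/ℚ_p) ≤ p − 2` comes from the TATE-EXACT local type of this seat's
`GenuineTowerLocalTypeTate` (Serre 1972 n° 1.12, unramified half, as proved in the tree from Kodaira–Néron): at a rational point, over a pole prime
`p ∉ {2, 3, 5, l}` of `j(λ)` with `3 ∣ ord_p j(λ)` (resp. `5 ∣`), EVERY place `u | p` of `T.K` has `e(u | p) ∣ 10·l` (resp. `∣ 6·l`); for an abc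
triple `ord_p j(a/c) = −2·v_p(abc)` exactly (`Cor22.ord_jInv_ratPoint_triple_eq`), so the conditions read `3 ∣ v_p(abc)`, `5 ∣ v_p(abc)`:
* `GenuineK.not_pilotKummerCompatHull_chosen_ratPoint_of_localType` — abc-iut-w5-d107's `…_ratPoint_of_tame_robust` with its fibre-point binder
  replaced by the PLACE-form local input «every place `u` of `T.K` of residue characteristic `p` has `e(u | p) ≤ p − 2`» (the shape every
  local-type lemma of the cell delivers);
* **`GenuineK.not_pilotKummerCompatHull_chosen_triple_of_ten_top`** — `p ∉ {2,3,5,l}`, **`10·l + 2 ≤ p`**, `p^v ∥ abc` with **`3 ∣ v`**,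
  top label `2l ≤ (l−3)·v` ⇒ ¬ S_H at every genuine Θ-volume datum over `(ratPoint (a/c), l)`, every choice of the free binders;
* **`GenuineK.not_pilotKummerCompatHull_chosen_triple_of_six_top`** — the same with **`6·l + 2 ≤ p`** and **`5 ∣ v`**.
HONEST SCOPE as in the parents: SHARP reading; per-label licence STRONGER than print; admissibility / Szpiro-badness / (P6) / non-emptiness of the
datum type NOT claimed; «refuted as typed» ≠ «refuted in print»; nothing about the number-level Corollary; typed ≠ proved; instantiated ≠ endorsed.
[cite: Mochizuki2012, IUTchIII Cor. 3.12 Step (xi-f) p. 184; IUTchIV Thm. 1.10 proof Steps (ii)–(iii) p. 24–26, Cor. 2.2 (ii) proof p. 44]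
[cite: Serre1972, §1.11–§1.12] [cite: MochizukiGenEll2010, Thm. 2.1 p. 11] [claim: Mochizuki2012, status: disputed] for every IUT sentence quoted.
-/

noncomputable section

open Set Function NumberField IsDedekindDomain

namespace Summit.ABC.IUTFork.Conditional

open Thm311 Thm311.Real Cor312 Cor312Vol Cor312Prov Literature.IUT.LogThetaLattice Literature.IUT.LogVolume
  Literature.IUT.HodgeTheaters Literature.IUT.LogVolume.ThetaData Literature.IUT.LogVolume.Cor22
open Literature.NumberTheory.NumberFields Literature.NumberTheory.GaloisRepresentations.Ultrametric
open Literature.NumberTheory.DiophantineGeometry Literature.NumberTheory.DiophantineGeometry.GenEll Summit.ABC.ABC.Theorems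

/-- **Per-datum refutation from a PLACE-form local type.** `λ ∈ ℚ`, `T` a genuine Θ-volume datum at `(ratPoint λ, l)`, an odd prime `p ≠ l` at
which `j(λ)` has a pole of order `≥ h ≥ 1`, a label `j = i₀+1 ≤ l⋆` with **`2l ≤ i₀·h`**, and the LOCAL-TYPE input in place form: every place `u` of
`T.K` of residue characteristic `p` is lattice-tame, `e(u | p) ≤ p − 2`. THEN the hull-level clause S_H (chosen ideles, pinned reading) FAILS for
every choice of the free context binders and Kummer datum (abc-iut-w5-d107's `…_ratPoint_of_tame_robust` at any fibre point `x₀ | p`, whose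
norm-defined `e(K_{x₀}/ℚ_p)` IS `e(placeOf x₀ | p)`, `absRamificationIdx_rescaledCompletion`). [cite: Mochizuki2012, IUTchIV Cor. 2.2 (ii) proof (P5) p. 46;
IUTchIII Cor. 3.12 Step (xi-f) p. 184] [claim: Mochizuki2012, status: disputed] -/
theorem GenuineK.not_pilotKummerCompatHull_chosen_ratPoint_of_localType {q : ℚ} {l : ℕ}
    (T : Cor22.ThetaVolumeDatumAt (ratPoint q) l) (pp : Nat.Primes) (hp2 : (pp : ℕ) ≠ 2) (hpl : (pp : ℕ) ≠ l)
    (hloc : letI := T.instFieldK; letI := T.instNumberFieldK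
      ∀ u : HeightOneSpectrum (𝓞 T.K), residueChar T.K u = (pp : ℕ) → u.asIdeal.ramificationIdx ℤ ≤ (pp : ℕ) - 2)
    (h : ℕ) (hh : 1 ≤ h)
    (hord : ∀ u : HeightOneSpectrum (𝓞 ℚ), Rat.HeightOneSpectrum.natGenerator u = (pp : ℕ) → ord ℚ u (Cor22.jInv q) ≤ -(h : ℤ))
    (i₀ : ℕ) (hil : i₀ + 1 ≤ (l - 1) / 2) (hi : 2 * l ≤ i₀ * h) :
    letI := T.instFieldF; letI := T.instNumberFieldF; letI := T.instAlgebraF; letI := T.instFieldK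
    letI := T.instNumberFieldK; letI := T.instAlgebraK; letI := T.instFieldFbar; letI := T.instAlgebraFbar
    letI := T.instAlgebraKFbar; letI := T.instIsElliptic
    haveI : Fact (pp : ℕ).Prime := ⟨pp.2⟩
    ∀ (M : Type) [Field M] [NumberField M]
      (archPk : ∀ (j : (thetaIndex (pilotDataOfK T.D T.K)).Label) (vQ : (thetaIndex (pilotDataOfK T.D T.K)).VQ),
        Set ((logShellsDH (pilotDataOfK T.D T.K) (analyticLogv T.K)).Packet j vQ))
      (archSub : ∀ (j : (thetaIndex (pilotDataOfK T.D T.K)).Label) (v : (thetaIndex (pilotDataOfK T.D T.K)).V),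
        Set ((logShellsDH (pilotDataOfK T.D T.K) (analyticLogv T.K)).Packet j ((thetaIndex (pilotDataOfK T.D T.K)).over v)))
      (Ψ : ℤ → ∀ v : (thetaIndex (pilotDataOfK T.D T.K)).V, v ∈ (thetaIndex (pilotDataOfK T.D T.K)).Vbad →
        Set ((logShellsDH (pilotDataOfK T.D T.K) (analyticLogv T.K)).StarPacket v))
      (act : ℤ → ∀ v : (thetaIndex (pilotDataOfK T.D T.K)).V, v ∈ (thetaIndex (pilotDataOfK T.D T.K)).Vbad →
        (logShellsDH (pilotDataOfK T.D T.K) (analyticLogv T.K)).StarPacket v →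
          Module.End ℚ ((logShellsDH (pilotDataOfK T.D T.K) (analyticLogv T.K)).StarPacket v))
      (Mmod : ℤ → ∀ j : (thetaIndex (pilotDataOfK T.D T.K)).LabelStar, Set ((logShellsDH (pilotDataOfK T.D T.K) (analyticLogv T.K)).GlobalPacket j.1))
      (region : ℤ → ∀ j : (thetaIndex (pilotDataOfK T.D T.K)).LabelStar, FinDivisor M → ∀ vQ : (thetaIndex (pilotDataOfK T.D T.K)).VQ,
        Set ((logShellsDH (pilotDataOfK T.D T.K) (analyticLogv T.K)).Packet j.1 vQ))
      (frobAdm : ℤ → ℤ → ∀ (j : (thetaIndex (pilotDataOfK T.D T.K)).Label) (vQ : (thetaIndex (pilotDataOfK T.D T.K)).VQ),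
        Set ((logShellsDH (pilotDataOfK T.D T.K) (analyticLogv T.K)).Packet j vQ) → Prop)
      (frobLogvol : ℤ → ℤ → ∀ (j : (thetaIndex (pilotDataOfK T.D T.K)).Label) (vQ : (thetaIndex (pilotDataOfK T.D T.K)).VQ),
        Set ((logShellsDH (pilotDataOfK T.D T.K) (analyticLogv T.K)).Packet j vQ) → ℝ)
      (frobΨ : ℤ → ℤ → ∀ v : (thetaIndex (pilotDataOfK T.D T.K)).V, v ∈ (thetaIndex (pilotDataOfK T.D T.K)).Vbad →
        Set ((logShellsDH (pilotDataOfK T.D T.K) (analyticLogv T.K)).StarPacket v))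
      (frobMmod : ℤ → ℤ → ∀ j : (thetaIndex (pilotDataOfK T.D T.K)).LabelStar, Set ((logShellsDH (pilotDataOfK T.D T.K) (analyticLogv T.K)).GlobalPacket j.1))
      (unitImage : ℤ → ℤ → ℕ → ∀ (j : (thetaIndex (pilotDataOfK T.D T.K)).Label) (vQ : (thetaIndex (pilotDataOfK T.D T.K)).VQ),
        Set ((logShellsDH (pilotDataOfK T.D T.K) (analyticLogv T.K)).Packet j vQ))
      (ballImage : ℤ → ℤ → ∀ (j : (thetaIndex (pilotDataOfK T.D T.K)).Label) (vQ : (thetaIndex (pilotDataOfK T.D T.K)).VQ),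
        Set ((logShellsDH (pilotDataOfK T.D T.K) (analyticLogv T.K)).Packet j vQ))
      (thetaDiv : ℤ → ℤ → LgpDivisor M (thetaIndex (pilotDataOfK T.D T.K)).lstar)
      (n : ℤ) {HT : Type} {LogLink : HT → HT → Type} {IsFull : ∀ {s t : HT}, LogLink s t → Prop}
      (lat : LGPGaussianLogThetaLattice LogLink IsFull)
      {Frd : Type} {IsoF : Frd → Frd → Type} {Ob : Frd → Type} {realify : Frd → Frd} {Strip : Type}
      {IsoS : Strip → Strip → Type} {Mv : ∀ v : (thetaIndex (pilotDataOfK T.D T.K)).V, v ∈ (thetaIndex (pilotDataOfK T.D T.K)).Vbad → Type}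
      [∀ v h, Monoid (Mv v h)]
      (sig : GlobalLGPFrobenioidSignature (thetaIndex (pilotDataOfK T.D T.K)).lstar (thetaIndex (pilotDataOfK T.D T.K)).V
        (· ∈ (thetaIndex (pilotDataOfK T.D T.K)).Vbad) Frd IsoF Ob realify Strip IsoS Mv)
      (split : SplittingMonoids Mv) {ObΔ : Type} {N : ∀ v : (thetaIndex (pilotDataOfK T.D T.K)).V, v ∈ (thetaIndex (pilotDataOfK T.D T.K)).Vbad → Type}
      [∀ v h, Monoid (N v h)] (qData : QPilotData ObΔ N)
      (qK : ∀ v : (thetaIndex (pilotDataOfK T.D T.K)).V, v ∈ (thetaIndex (pilotDataOfK T.D T.K)).Vbad →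
        Set ((logShellsDH (pilotDataOfK T.D T.K) (analyticLogv T.K)).StarPacket v)),
      ¬ Cor312Vol.PilotKummerCompatHull
          (LatticeSituation.ofShells (logShellsDH (pilotDataOfK T.D T.K) (analyticLogv T.K)) M archPk archSub
            (summandPiecesPr (pilotDataOfK T.D T.K) (logvAnalytic_analyticLogv (F := T.K))).Adm
            (summandPiecesPr (pilotDataOfK T.D T.K) (logvAnalytic_analyticLogv (F := T.K))).logvol Ψ act Mmod region frobAdm frobLogvol frobΨ
            frobMmod unitImage ballImage thetaDiv)
          (settingPrVolSharp (pilotDataOfK T.D T.K) (logvAnalytic_analyticLogv (F := T.K)) M archPk archSub Ψ act Mmod region n lat sig split qData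
            (exists_realising_qIdeles_pilotDataOfK T.D).choose (exists_realising_thetaIdeles_pilotDataOfK T.D).choose
            (exists_realising_qIdeles_pilotDataOfK T.D).choose_spec.1 (exists_realising_qIdeles_pilotDataOfK T.D).choose_spec.2.1)
          (fun _ => Cor312.Setting.qRegion
            (settingPrVolSharp (pilotDataOfK T.D T.K) (logvAnalytic_analyticLogv (F := T.K)) M archPk archSub Ψ act Mmod region n lat sig split qData
              (exists_realising_qIdeles_pilotDataOfK T.D).choose (exists_realising_thetaIdeles_pilotDataOfK T.D).choose
              (exists_realising_qIdeles_pilotDataOfK T.D).choose_spec.1 (exists_realising_qIdeles_pilotDataOfK T.D).choose_spec.2.1)) qK := by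
  classical
  letI := T.instFieldF; letI := T.instNumberFieldF; letI := T.instAlgebraF; letI := T.instFieldK
  letI := T.instNumberFieldK; letI := T.instAlgebraK; letI := T.instFieldFbar; letI := T.instAlgebraFbar
  letI := T.instAlgebraKFbar; letI := T.instIsElliptic
  haveI : Fact (pp : ℕ).Prime := ⟨pp.2⟩
  intro M _ _ archPk archSub Ψ act Mmod region frobAdm frobLogvol frobΨ frobMmod unitImage ballImage thetaDiv n HT LogLink IsFull lat
    Frd IsoF Ob realify Strip IsoS Mv _ sig split ObΔ N _ qData qK
  obtain ⟨v, hv⟩ := (thetaIndex (pilotDataOfK T.D T.K)).fibre_nonempty (.inr pp)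
  set w := placeOf (pilotDataOfK T.D T.K) pp.1 ⟨v, hv⟩ with hwdef
  have hpw : ((pp : ℕ) : 𝓞 T.K) ∈ w.asIdeal := natCast_mem_placeOf (pilotDataOfK T.D T.K) pp.1 ⟨v, hv⟩
  have hwchar : residueChar T.K w = (pp : ℕ) := residueChar_eq_of_natCast_mem pp.1 hpw
  have hx₀ : absRamificationIdx (pp : ℕ) (kOf (pilotDataOfK T.D T.K) pp.1 ⟨v, hv⟩) ≤ (pp : ℕ) - 2 := by
    rw [show absRamificationIdx (pp : ℕ) (kOf (pilotDataOfK T.D T.K) pp.1 ⟨v, hv⟩) = w.asIdeal.ramificationIdx ℤ from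
      absRamificationIdx_rescaledCompletion T.K (pp : ℕ) w hpw]
    exact hloc w hwchar
  exact GenuineK.not_pilotKummerCompatHull_chosen_ratPoint_of_tame_robust T pp hp2 hpl h hh hord i₀ hil hi ⟨v, hv⟩ hx₀ M archPk archSub
    Ψ act Mmod region frobAdm frobLogvol frobΨ frobMmod unitImage ballImage thetaDiv n lat sig split qData qK

/-- **abc-TRIPLE form, TOP LABEL `j = l⋆`, prime floor `10·l + 2`, Tate-exact local type.** `a + b = c` coprime, `λ = a/c`, `T` a genuine
Θ-volume datum at `(ratPoint (a/c), l)`, a prime `p ∉ {2, 3, 5, l}` with **`10·l + 2 ≤ p`**, `p^v ∣ abc`, `p^{v+1} ∤ abc` (`v = v_p(abc) ≥ 1`) with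
**`3 ∣ v`**, and **`2l ≤ (l−3)·v`**. THEN ¬ S_H at `T` for every choice of the free binders — UNCONDITIONALLY: `ord_p j(a/c) = −2v`
(`Cor22.ord_jInv_ratPoint_triple_eq`), so `3 ∣ ord_p j(a/c)` and every `u | p` of `T.K` has `e(u | p) ∣ 10·l ≤ p − 2`
(`Cor22.ThetaVolumeDatumAt.ramificationIdx_int_dvd_ten_mul_ratPoint'`, Serre 1972 n° 1.12). [cite: Mochizuki2012, IUTchIII Cor. 3.12 Step (xi-f) p. 184;
IUTchIV Thm. 1.10 proof Steps (ii)–(iii) p. 24–26, Cor. 2.2 (ii) proof p. 44] [cite: Serre1972, §1.11–§1.12] [claim: Mochizuki2012, status: disputed] -/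
theorem GenuineK.not_pilotKummerCompatHull_chosen_triple_of_ten_top {a b c : ℕ} (habc : IsABCTriple a b c) {l : ℕ}
    (T : Cor22.ThetaVolumeDatumAt (ratPoint ((a : ℚ) / c)) l) (pp : Nat.Primes) (hp2 : (pp : ℕ) ≠ 2) (hp3 : (pp : ℕ) ≠ 3)
    (hp5 : (pp : ℕ) ≠ 5) (hpl : (pp : ℕ) ≠ l) (hfloor : 10 * l + 2 ≤ (pp : ℕ)) (v : ℕ) (hv : 1 ≤ v) (hdvd : (pp : ℕ) ^ v ∣ a * b * c)
    (hndvd : ¬ (pp : ℕ) ^ (v + 1) ∣ a * b * c) (hqv : 3 ∣ v) (h4 : 2 * l ≤ (l - 3) * v) :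
    letI := T.instFieldF; letI := T.instNumberFieldF; letI := T.instAlgebraF; letI := T.instFieldK
    letI := T.instNumberFieldK; letI := T.instAlgebraK; letI := T.instFieldFbar; letI := T.instAlgebraFbar
    letI := T.instAlgebraKFbar; letI := T.instIsElliptic
    haveI : Fact (pp : ℕ).Prime := ⟨pp.2⟩
    ∀ (M : Type) [Field M] [NumberField M]
      (archPk : ∀ (j : (thetaIndex (pilotDataOfK T.D T.K)).Label) (vQ : (thetaIndex (pilotDataOfK T.D T.K)).VQ),
        Set ((logShellsDH (pilotDataOfK T.D T.K) (analyticLogv T.K)).Packet j vQ))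
      (archSub : ∀ (j : (thetaIndex (pilotDataOfK T.D T.K)).Label) (v : (thetaIndex (pilotDataOfK T.D T.K)).V),
        Set ((logShellsDH (pilotDataOfK T.D T.K) (analyticLogv T.K)).Packet j ((thetaIndex (pilotDataOfK T.D T.K)).over v)))
      (Ψ : ℤ → ∀ v : (thetaIndex (pilotDataOfK T.D T.K)).V, v ∈ (thetaIndex (pilotDataOfK T.D T.K)).Vbad →
        Set ((logShellsDH (pilotDataOfK T.D T.K) (analyticLogv T.K)).StarPacket v))
      (act : ℤ → ∀ v : (thetaIndex (pilotDataOfK T.D T.K)).V, v ∈ (thetaIndex (pilotDataOfK T.D T.K)).Vbad →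
        (logShellsDH (pilotDataOfK T.D T.K) (analyticLogv T.K)).StarPacket v →
          Module.End ℚ ((logShellsDH (pilotDataOfK T.D T.K) (analyticLogv T.K)).StarPacket v))
      (Mmod : ℤ → ∀ j : (thetaIndex (pilotDataOfK T.D T.K)).LabelStar, Set ((logShellsDH (pilotDataOfK T.D T.K) (analyticLogv T.K)).GlobalPacket j.1))
      (region : ℤ → ∀ j : (thetaIndex (pilotDataOfK T.D T.K)).LabelStar, FinDivisor M → ∀ vQ : (thetaIndex (pilotDataOfK T.D T.K)).VQ,
        Set ((logShellsDH (pilotDataOfK T.D T.K) (analyticLogv T.K)).Packet j.1 vQ))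
      (frobAdm : ℤ → ℤ → ∀ (j : (thetaIndex (pilotDataOfK T.D T.K)).Label) (vQ : (thetaIndex (pilotDataOfK T.D T.K)).VQ),
        Set ((logShellsDH (pilotDataOfK T.D T.K) (analyticLogv T.K)).Packet j vQ) → Prop)
      (frobLogvol : ℤ → ℤ → ∀ (j : (thetaIndex (pilotDataOfK T.D T.K)).Label) (vQ : (thetaIndex (pilotDataOfK T.D T.K)).VQ),
        Set ((logShellsDH (pilotDataOfK T.D T.K) (analyticLogv T.K)).Packet j vQ) → ℝ)
      (frobΨ : ℤ → ℤ → ∀ v : (thetaIndex (pilotDataOfK T.D T.K)).V, v ∈ (thetaIndex (pilotDataOfK T.D T.K)).Vbad →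
        Set ((logShellsDH (pilotDataOfK T.D T.K) (analyticLogv T.K)).StarPacket v))
      (frobMmod : ℤ → ℤ → ∀ j : (thetaIndex (pilotDataOfK T.D T.K)).LabelStar, Set ((logShellsDH (pilotDataOfK T.D T.K) (analyticLogv T.K)).GlobalPacket j.1))
      (unitImage : ℤ → ℤ → ℕ → ∀ (j : (thetaIndex (pilotDataOfK T.D T.K)).Label) (vQ : (thetaIndex (pilotDataOfK T.D T.K)).VQ),
        Set ((logShellsDH (pilotDataOfK T.D T.K) (analyticLogv T.K)).Packet j vQ))
      (ballImage : ℤ → ℤ → ∀ (j : (thetaIndex (pilotDataOfK T.D T.K)).Label) (vQ : (thetaIndex (pilotDataOfK T.D T.K)).VQ),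
        Set ((logShellsDH (pilotDataOfK T.D T.K) (analyticLogv T.K)).Packet j vQ))
      (thetaDiv : ℤ → ℤ → LgpDivisor M (thetaIndex (pilotDataOfK T.D T.K)).lstar)
      (n : ℤ) {HT : Type} {LogLink : HT → HT → Type} {IsFull : ∀ {s t : HT}, LogLink s t → Prop}
      (lat : LGPGaussianLogThetaLattice LogLink IsFull)
      {Frd : Type} {IsoF : Frd → Frd → Type} {Ob : Frd → Type} {realify : Frd → Frd} {Strip : Type}
      {IsoS : Strip → Strip → Type} {Mv : ∀ v : (thetaIndex (pilotDataOfK T.D T.K)).V, v ∈ (thetaIndex (pilotDataOfK T.D T.K)).Vbad → Type}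
      [∀ v h, Monoid (Mv v h)]
      (sig : GlobalLGPFrobenioidSignature (thetaIndex (pilotDataOfK T.D T.K)).lstar (thetaIndex (pilotDataOfK T.D T.K)).V
        (· ∈ (thetaIndex (pilotDataOfK T.D T.K)).Vbad) Frd IsoF Ob realify Strip IsoS Mv)
      (split : SplittingMonoids Mv) {ObΔ : Type} {N : ∀ v : (thetaIndex (pilotDataOfK T.D T.K)).V, v ∈ (thetaIndex (pilotDataOfK T.D T.K)).Vbad → Type}
      [∀ v h, Monoid (N v h)] (qData : QPilotData ObΔ N)
      (qK : ∀ v : (thetaIndex (pilotDataOfK T.D T.K)).V, v ∈ (thetaIndex (pilotDataOfK T.D T.K)).Vbad →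
        Set ((logShellsDH (pilotDataOfK T.D T.K) (analyticLogv T.K)).StarPacket v)),
      ¬ Cor312Vol.PilotKummerCompatHull
          (LatticeSituation.ofShells (logShellsDH (pilotDataOfK T.D T.K) (analyticLogv T.K)) M archPk archSub
            (summandPiecesPr (pilotDataOfK T.D T.K) (logvAnalytic_analyticLogv (F := T.K))).Adm
            (summandPiecesPr (pilotDataOfK T.D T.K) (logvAnalytic_analyticLogv (F := T.K))).logvol Ψ act Mmod region frobAdm frobLogvol frobΨ
            frobMmod unitImage ballImage thetaDiv)
          (settingPrVolSharp (pilotDataOfK T.D T.K) (logvAnalytic_analyticLogv (F := T.K)) M archPk archSub Ψ act Mmod region n lat sig split qData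
            (exists_realising_qIdeles_pilotDataOfK T.D).choose (exists_realising_thetaIdeles_pilotDataOfK T.D).choose
            (exists_realising_qIdeles_pilotDataOfK T.D).choose_spec.1 (exists_realising_qIdeles_pilotDataOfK T.D).choose_spec.2.1)
          (fun _ => Cor312.Setting.qRegion
            (settingPrVolSharp (pilotDataOfK T.D T.K) (logvAnalytic_analyticLogv (F := T.K)) M archPk archSub Ψ act Mmod region n lat sig split qData
              (exists_realising_qIdeles_pilotDataOfK T.D).choose (exists_realising_thetaIdeles_pilotDataOfK T.D).choose
              (exists_realising_qIdeles_pilotDataOfK T.D).choose_spec.1 (exists_realising_qIdeles_pilotDataOfK T.D).choose_spec.2.1)) qK := by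
  letI := T.instFieldF; letI := T.instNumberFieldF; letI := T.instAlgebraF; letI := T.instFieldK
  letI := T.instNumberFieldK; letI := T.instAlgebraK; letI := T.instFieldFbar; letI := T.instAlgebraFbar
  letI := T.instAlgebraKFbar; letI := T.instIsElliptic
  -- `v_p(abc) = v`
  have habc0 : a * b * c ≠ 0 := by
    obtain ⟨ha, hb, hsum, -⟩ := habc
    exact Nat.mul_ne_zero (Nat.mul_ne_zero ha.ne' hb.ne') (by omega)
  have hfac : (a * b * c).factorization (pp : ℕ) = v := by
    have h1 : v ≤ (a * b * c).factorization (pp : ℕ) := (pp.2.pow_dvd_iff_le_factorization habc0).1 hdvd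
    have h2 : ¬ v + 1 ≤ (a * b * c).factorization (pp : ℕ) := fun h' =>
      hndvd ((pp.2.pow_dvd_iff_le_factorization habc0).2 h')
    omega
  have hpabc : (pp : ℕ) ∣ a * b * c := (dvd_pow_self _ (by omega)).trans hdvd
  -- `ord_p j(a/c) = −2v`: pole order exactly `2v`, and `3 ∣ ord_p j(a/c)`
  have hordeq : ∀ u : HeightOneSpectrum (𝓞 ℚ), Rat.HeightOneSpectrum.natGenerator u = (pp : ℕ) →
      ord ℚ u (Cor22.jInv ((a : ℚ) / c)) = -((2 * v : ℕ) : ℤ) := by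
    intro u hu
    rw [Cor22.ord_jInv_ratPoint_triple_eq habc u (hu ▸ hp2) (hu ▸ hpabc), hu, hfac]
    push_cast
    ring
  have hord : ∀ u : HeightOneSpectrum (𝓞 ℚ), Rat.HeightOneSpectrum.natGenerator u = (pp : ℕ) →
      ord ℚ u (Cor22.jInv ((a : ℚ) / c)) ≤ -((2 * v : ℕ) : ℤ) := fun u hu => (hordeq u hu).le
  have hpole : ∀ u : HeightOneSpectrum (𝓞 ℚ), Rat.HeightOneSpectrum.natGenerator u = (pp : ℕ) →
      ord ℚ u (Cor22.jInv ((a : ℚ) / c)) < 0 := fun u hu => by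
    rw [hordeq u hu]; push_cast; omega
  have hordq : ∀ u : HeightOneSpectrum (𝓞 ℚ), Rat.HeightOneSpectrum.natGenerator u = (pp : ℕ) →
      (3 : ℤ) ∣ ord ℚ u (Cor22.jInv ((a : ℚ) / c)) := fun u hu => by
    exact_mod_cast Cor22.natCast_dvd_ord_jInv_ratPoint_triple habc hp2 hpabc (n := 3) (by rw [hfac]; exact hqv) u hu
  -- the Tate-exact local type: every `u | p` of `T.K` has `e(u | p) ∣ 10·l ≤ p − 2`
  have hnot : (pp : ℕ) ∉ ({2, 3, 5, l} : Finset ℕ) := by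
    simp only [Finset.mem_insert, Finset.mem_singleton, not_or]
    exact ⟨hp2, hp3, hp5, hpl⟩
  have hl0 : 0 < l := by
    have := T.D.five_le_l
    omega
  have hloc : ∀ u : HeightOneSpectrum (𝓞 T.K), residueChar T.K u = (pp : ℕ) → u.asIdeal.ramificationIdx ℤ ≤ (pp : ℕ) - 2 :=
    fun u hu => (Nat.le_of_dvd (by omega) (T.ramificationIdx_int_dvd_ten_mul_ratPoint' hnot hpole hordq u hu)).trans (by omega)
  -- the top label `i₀ = l⋆ − 1`
  have hl : l.Prime := T.D.l_prime
  have hl5 : 5 ≤ l := T.D.five_le_l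
  have hodd : l % 2 = 1 := by
    rcases hl.eq_two_or_odd with h2 | h2
    · omega
    · exact h2
  have htop : 2 * l ≤ ((l - 1) / 2 - 1) * (2 * v) :=
    TameRobust.top_label_test (h := 2 * v) hodd (by omega) (by nlinarith [h4])
  exact GenuineK.not_pilotKummerCompatHull_chosen_ratPoint_of_localType T pp hp2 hpl hloc (2 * v) (by omega) hord
    ((l - 1) / 2 - 1) (by omega) htop

/-- **abc-TRIPLE form, TOP LABEL `j = l⋆`, prime floor `6·l + 2`, Tate-exact local type.** `a + b = c` coprime, `λ = a/c`, `T` a genuine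
Θ-volume datum at `(ratPoint (a/c), l)`, a prime `p ∉ {2, 3, 5, l}` with **`6·l + 2 ≤ p`**, `p^v ∣ abc`, `p^{v+1} ∤ abc` (`v = v_p(abc) ≥ 1`) with
**`5 ∣ v`**, and **`2l ≤ (l−3)·v`**. THEN ¬ S_H at `T` for every choice of the free binders — UNCONDITIONALLY: `ord_p j(a/c) = −2v`
(`Cor22.ord_jInv_ratPoint_triple_eq`), so `5 ∣ ord_p j(a/c)` and every `u | p` of `T.K` has `e(u | p) ∣ 6·l ≤ p − 2`
(`Cor22.ThetaVolumeDatumAt.ramificationIdx_int_dvd_six_mul_ratPoint'`, Serre 1972 n° 1.12). [cite: Mochizuki2012, IUTchIII Cor. 3.12 Step (xi-f) p. 184;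
IUTchIV Thm. 1.10 proof Steps (ii)–(iii) p. 24–26, Cor. 2.2 (ii) proof p. 44] [cite: Serre1972, §1.11–§1.12] [claim: Mochizuki2012, status: disputed] -/
theorem GenuineK.not_pilotKummerCompatHull_chosen_triple_of_six_top {a b c : ℕ} (habc : IsABCTriple a b c) {l : ℕ}
    (T : Cor22.ThetaVolumeDatumAt (ratPoint ((a : ℚ) / c)) l) (pp : Nat.Primes) (hp2 : (pp : ℕ) ≠ 2) (hp3 : (pp : ℕ) ≠ 3)
    (hp5 : (pp : ℕ) ≠ 5) (hpl : (pp : ℕ) ≠ l) (hfloor : 6 * l + 2 ≤ (pp : ℕ)) (v : ℕ) (hv : 1 ≤ v) (hdvd : (pp : ℕ) ^ v ∣ a * b * c)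
    (hndvd : ¬ (pp : ℕ) ^ (v + 1) ∣ a * b * c) (hqv : 5 ∣ v) (h4 : 2 * l ≤ (l - 3) * v) :
    letI := T.instFieldF; letI := T.instNumberFieldF; letI := T.instAlgebraF; letI := T.instFieldK
    letI := T.instNumberFieldK; letI := T.instAlgebraK; letI := T.instFieldFbar; letI := T.instAlgebraFbar
    letI := T.instAlgebraKFbar; letI := T.instIsElliptic
    haveI : Fact (pp : ℕ).Prime := ⟨pp.2⟩
    ∀ (M : Type) [Field M] [NumberField M]
      (archPk : ∀ (j : (thetaIndex (pilotDataOfK T.D T.K)).Label) (vQ : (thetaIndex (pilotDataOfK T.D T.K)).VQ),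
        Set ((logShellsDH (pilotDataOfK T.D T.K) (analyticLogv T.K)).Packet j vQ))
      (archSub : ∀ (j : (thetaIndex (pilotDataOfK T.D T.K)).Label) (v : (thetaIndex (pilotDataOfK T.D T.K)).V),
        Set ((logShellsDH (pilotDataOfK T.D T.K) (analyticLogv T.K)).Packet j ((thetaIndex (pilotDataOfK T.D T.K)).over v)))
      (Ψ : ℤ → ∀ v : (thetaIndex (pilotDataOfK T.D T.K)).V, v ∈ (thetaIndex (pilotDataOfK T.D T.K)).Vbad →
        Set ((logShellsDH (pilotDataOfK T.D T.K) (analyticLogv T.K)).StarPacket v))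
      (act : ℤ → ∀ v : (thetaIndex (pilotDataOfK T.D T.K)).V, v ∈ (thetaIndex (pilotDataOfK T.D T.K)).Vbad →
        (logShellsDH (pilotDataOfK T.D T.K) (analyticLogv T.K)).StarPacket v →
          Module.End ℚ ((logShellsDH (pilotDataOfK T.D T.K) (analyticLogv T.K)).StarPacket v))
      (Mmod : ℤ → ∀ j : (thetaIndex (pilotDataOfK T.D T.K)).LabelStar, Set ((logShellsDH (pilotDataOfK T.D T.K) (analyticLogv T.K)).GlobalPacket j.1))
      (region : ℤ → ∀ j : (thetaIndex (pilotDataOfK T.D T.K)).LabelStar, FinDivisor M → ∀ vQ : (thetaIndex (pilotDataOfK T.D T.K)).VQ,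
        Set ((logShellsDH (pilotDataOfK T.D T.K) (analyticLogv T.K)).Packet j.1 vQ))
      (frobAdm : ℤ → ℤ → ∀ (j : (thetaIndex (pilotDataOfK T.D T.K)).Label) (vQ : (thetaIndex (pilotDataOfK T.D T.K)).VQ),
        Set ((logShellsDH (pilotDataOfK T.D T.K) (analyticLogv T.K)).Packet j vQ) → Prop)
      (frobLogvol : ℤ → ℤ → ∀ (j : (thetaIndex (pilotDataOfK T.D T.K)).Label) (vQ : (thetaIndex (pilotDataOfK T.D T.K)).VQ),
        Set ((logShellsDH (pilotDataOfK T.D T.K) (analyticLogv T.K)).Packet j vQ) → ℝ)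
      (frobΨ : ℤ → ℤ → ∀ v : (thetaIndex (pilotDataOfK T.D T.K)).V, v ∈ (thetaIndex (pilotDataOfK T.D T.K)).Vbad →
        Set ((logShellsDH (pilotDataOfK T.D T.K) (analyticLogv T.K)).StarPacket v))
      (frobMmod : ℤ → ℤ → ∀ j : (thetaIndex (pilotDataOfK T.D T.K)).LabelStar, Set ((logShellsDH (pilotDataOfK T.D T.K) (analyticLogv T.K)).GlobalPacket j.1))
      (unitImage : ℤ → ℤ → ℕ → ∀ (j : (thetaIndex (pilotDataOfK T.D T.K)).Label) (vQ : (thetaIndex (pilotDataOfK T.D T.K)).VQ),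
        Set ((logShellsDH (pilotDataOfK T.D T.K) (analyticLogv T.K)).Packet j vQ))
      (ballImage : ℤ → ℤ → ∀ (j : (thetaIndex (pilotDataOfK T.D T.K)).Label) (vQ : (thetaIndex (pilotDataOfK T.D T.K)).VQ),
        Set ((logShellsDH (pilotDataOfK T.D T.K) (analyticLogv T.K)).Packet j vQ))
      (thetaDiv : ℤ → ℤ → LgpDivisor M (thetaIndex (pilotDataOfK T.D T.K)).lstar)
      (n : ℤ) {HT : Type} {LogLink : HT → HT → Type} {IsFull : ∀ {s t : HT}, LogLink s t → Prop}
      (lat : LGPGaussianLogThetaLattice LogLink IsFull)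
      {Frd : Type} {IsoF : Frd → Frd → Type} {Ob : Frd → Type} {realify : Frd → Frd} {Strip : Type}
      {IsoS : Strip → Strip → Type} {Mv : ∀ v : (thetaIndex (pilotDataOfK T.D T.K)).V, v ∈ (thetaIndex (pilotDataOfK T.D T.K)).Vbad → Type}
      [∀ v h, Monoid (Mv v h)]
      (sig : GlobalLGPFrobenioidSignature (thetaIndex (pilotDataOfK T.D T.K)).lstar (thetaIndex (pilotDataOfK T.D T.K)).V
        (· ∈ (thetaIndex (pilotDataOfK T.D T.K)).Vbad) Frd IsoF Ob realify Strip IsoS Mv)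
      (split : SplittingMonoids Mv) {ObΔ : Type} {N : ∀ v : (thetaIndex (pilotDataOfK T.D T.K)).V, v ∈ (thetaIndex (pilotDataOfK T.D T.K)).Vbad → Type}
      [∀ v h, Monoid (N v h)] (qData : QPilotData ObΔ N)
      (qK : ∀ v : (thetaIndex (pilotDataOfK T.D T.K)).V, v ∈ (thetaIndex (pilotDataOfK T.D T.K)).Vbad →
        Set ((logShellsDH (pilotDataOfK T.D T.K) (analyticLogv T.K)).StarPacket v)),
      ¬ Cor312Vol.PilotKummerCompatHull
          (LatticeSituation.ofShells (logShellsDH (pilotDataOfK T.D T.K) (analyticLogv T.K)) M archPk archSub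
            (summandPiecesPr (pilotDataOfK T.D T.K) (logvAnalytic_analyticLogv (F := T.K))).Adm
            (summandPiecesPr (pilotDataOfK T.D T.K) (logvAnalytic_analyticLogv (F := T.K))).logvol Ψ act Mmod region frobAdm frobLogvol frobΨ
            frobMmod unitImage ballImage thetaDiv)
          (settingPrVolSharp (pilotDataOfK T.D T.K) (logvAnalytic_analyticLogv (F := T.K)) M archPk archSub Ψ act Mmod region n lat sig split qData
            (exists_realising_qIdeles_pilotDataOfK T.D).choose (exists_realising_thetaIdeles_pilotDataOfK T.D).choose
            (exists_realising_qIdeles_pilotDataOfK T.D).choose_spec.1 (exists_realising_qIdeles_pilotDataOfK T.D).choose_spec.2.1)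
          (fun _ => Cor312.Setting.qRegion
            (settingPrVolSharp (pilotDataOfK T.D T.K) (logvAnalytic_analyticLogv (F := T.K)) M archPk archSub Ψ act Mmod region n lat sig split qData
              (exists_realising_qIdeles_pilotDataOfK T.D).choose (exists_realising_thetaIdeles_pilotDataOfK T.D).choose
              (exists_realising_qIdeles_pilotDataOfK T.D).choose_spec.1 (exists_realising_qIdeles_pilotDataOfK T.D).choose_spec.2.1)) qK := by
  letI := T.instFieldF; letI := T.instNumberFieldF; letI := T.instAlgebraF; letI := T.instFieldK
  letI := T.instNumberFieldK; letI := T.instAlgebraK; letI := T.instFieldFbar; letI := T.instAlgebraFbar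
  letI := T.instAlgebraKFbar; letI := T.instIsElliptic
  -- `v_p(abc) = v`
  have habc0 : a * b * c ≠ 0 := by
    obtain ⟨ha, hb, hsum, -⟩ := habc
    exact Nat.mul_ne_zero (Nat.mul_ne_zero ha.ne' hb.ne') (by omega)
  have hfac : (a * b * c).factorization (pp : ℕ) = v := by
    have h1 : v ≤ (a * b * c).factorization (pp : ℕ) := (pp.2.pow_dvd_iff_le_factorization habc0).1 hdvd
    have h2 : ¬ v + 1 ≤ (a * b * c).factorization (pp : ℕ) := fun h' =>
      hndvd ((pp.2.pow_dvd_iff_le_factorization habc0).2 h')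
    omega
  have hpabc : (pp : ℕ) ∣ a * b * c := (dvd_pow_self _ (by omega)).trans hdvd
  -- `ord_p j(a/c) = −2v`: pole order exactly `2v`, and `5 ∣ ord_p j(a/c)`
  have hordeq : ∀ u : HeightOneSpectrum (𝓞 ℚ), Rat.HeightOneSpectrum.natGenerator u = (pp : ℕ) →
      ord ℚ u (Cor22.jInv ((a : ℚ) / c)) = -((2 * v : ℕ) : ℤ) := by
    intro u hu
    rw [Cor22.ord_jInv_ratPoint_triple_eq habc u (hu ▸ hp2) (hu ▸ hpabc), hu, hfac]
    push_cast
    ring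
  have hord : ∀ u : HeightOneSpectrum (𝓞 ℚ), Rat.HeightOneSpectrum.natGenerator u = (pp : ℕ) →
      ord ℚ u (Cor22.jInv ((a : ℚ) / c)) ≤ -((2 * v : ℕ) : ℤ) := fun u hu => (hordeq u hu).le
  have hpole : ∀ u : HeightOneSpectrum (𝓞 ℚ), Rat.HeightOneSpectrum.natGenerator u = (pp : ℕ) →
      ord ℚ u (Cor22.jInv ((a : ℚ) / c)) < 0 := fun u hu => by
    rw [hordeq u hu]; push_cast; omega
  have hordq : ∀ u : HeightOneSpectrum (𝓞 ℚ), Rat.HeightOneSpectrum.natGenerator u = (pp : ℕ) →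
      (5 : ℤ) ∣ ord ℚ u (Cor22.jInv ((a : ℚ) / c)) := fun u hu => by
    exact_mod_cast Cor22.natCast_dvd_ord_jInv_ratPoint_triple habc hp2 hpabc (n := 5) (by rw [hfac]; exact hqv) u hu
  -- the Tate-exact local type: every `u | p` of `T.K` has `e(u | p) ∣ 6·l ≤ p − 2`
  have hnot : (pp : ℕ) ∉ ({2, 3, 5, l} : Finset ℕ) := by
    simp only [Finset.mem_insert, Finset.mem_singleton, not_or]
    exact ⟨hp2, hp3, hp5, hpl⟩
  have hl0 : 0 < l := by
    have := T.D.five_le_l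
    omega
  have hloc : ∀ u : HeightOneSpectrum (𝓞 T.K), residueChar T.K u = (pp : ℕ) → u.asIdeal.ramificationIdx ℤ ≤ (pp : ℕ) - 2 :=
    fun u hu => (Nat.le_of_dvd (by omega) (T.ramificationIdx_int_dvd_six_mul_ratPoint' hnot hpole hordq u hu)).trans (by omega)
  -- the top label `i₀ = l⋆ − 1`
  have hl : l.Prime := T.D.l_prime
  have hl5 : 5 ≤ l := T.D.five_le_l
  have hodd : l % 2 = 1 := by
    rcases hl.eq_two_or_odd with h2 | h2
    · omega
    · exact h2
  have htop : 2 * l ≤ ((l - 1) / 2 - 1) * (2 * v) :=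
    TameRobust.top_label_test (h := 2 * v) hodd (by omega) (by nlinarith [h4])
  exact GenuineK.not_pilotKummerCompatHull_chosen_ratPoint_of_localType T pp hp2 hpl hloc (2 * v) (by omega) hord
    ((l - 1) / 2 - 1) (by omega) htop

end Summit.ABC.IUTFork.Conditional

end
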